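import Literature.Analysis.FluidPDE.ConvexIntegration2DPlaneWavesEnergy
import HarnessLib

/-!
# Convex integration in 2-D: time slices (slice calculus, slice estimates for localized plane waves)

Topic `Analysis/FluidPDE`. Support file (sliced layer 1) for the proof of Székelyhidi's localized
convex-integration theorem `Torus.Szekelyhidi2011_thm13` (`EulerSubsolutionCriterion.lean`;
= De Lellis–Székelyhidi 2010, Prop. 2, whose conclusion (iv) `½|v(x,t)|² = ē(x,t)` holds
*for every* time `t`). The constructive iteration of `ConvexIntegration2DIteration.lean`
(Chiodaroli–De Lellis–Kreml 2015, on `ℝ × ℝ²`) controls space–time integrals only; the every-time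
conclusions of DLSz 2010 rest on the same estimates *on each time slice, uniformly in `t`*
(DLSz 2010, Lemma 4.9: `∫_B sin²(N η·(x,t)) dx → |B|/2` uniformly in `t`; §4.5, Step 3:
`∫ ṽ_N(x,t)·v(x,t) dx → 0` uniformly in `t`). This file provides, on `ST = ℝ × ℝ²`:

* slices `x ↦ F(t,x)`: chain rule (`fderiv_slice_apply`, `pd_dXv_eq_fderiv_slice`), smoothness,
  compact support, uniform bounds of slice `L¹` norms (`exists_forall_integral_slice_abs_le`),
  continuity of `t ↦ ∫ F(t,x) dx` (`continuous_integral_slice`), and integration by parts in `x`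
  on a slice (`integral_slice_pd_mul_eq_neg`, `integral_slice_pd_eq_zero`);
* the non-stationary phase bound on slices, uniformly in `t` (`abs_integral_slice_mul_osc_le`,
  `exists_forall_abs_integral_slice_mul_osc_le`): for `F ∈ C¹_c(ℝ × ℝ²)` and a frequency `η` with
  non-zero spatial part, `sup_t |∫ F(t,x) cos(Nφ_η(t,x) + kπ/2) dx| ≤ K/N`;
* for a localized plane wave `d.wave N` of `ConvexIntegration2DPlaneWaves.lean` (CDK Prop. 4.1):
  uniform-in-`t` near-orthogonality of its slices to `C¹_c` amplitudes
  (`wave_slice_integral_mul_eventually`), the slice energy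
  `|∫ (wave₀² + wave₁²)(t,x) dx - A²/2 ∫ χ(t,x)² dx| ≤ ε` eventually in `N`, uniformly in `t`
  (`wave_slice_energy_eventually`; DLSz Lemma 4.9), and the lower bound `∫ χ(t,x)² dx ≥ |B_{r/2}|`
  on the fully active slices `|t - t₀| < r/2` (`volume_ball_le_integral_slice_cutoff_sq`).

## References

* C. De Lellis, L. Székelyhidi Jr., *On admissibility criteria for weak solutions of the Euler
  equations*, Arch. Ration. Mech. Anal. 195 (2010) 225–260, Lemma 4.9 and §4.5, Steps 2–3.
* E. Chiodaroli, C. De Lellis, O. Kreml, Comm. Pure Appl. Math. 68 (2015) 1157–1190, Prop. 4.1.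
-/

noncomputable section

open MeasureTheory Set Metric Filter Function
open scoped ContDiff Topology

namespace Literature.Analysis.FluidPDE.ConvexIntegration

/-! ### Slices of space–time functions -/

/-- The spatial direction `(0, v)` of space–time `ℝ × ℝ²`. [folklore] -/
def dXv (v : E2) : ST := (0, v)

/-- `dX j` is the spatial direction of the `j`-th coordinate vector. [folklore] -/
theorem dX_eq_dXv (j : Fin 2) : dX j = dXv (EuclideanSpace.single j 1) := rfl

/-- The phase of a spatial direction is the inner product with the spatial frequency. [folklore] -/
theorem phaseL_dXv (η : ST) (v : E2) : phaseL η (dXv v) = inner ℝ η.2 v := by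
  simp [phaseL_apply, dXv]

/-- **Chain rule for slices:** `D(F(t,·))(x) v = DF(t,x) (0,v)`. [folklore] -/
theorem fderiv_slice_apply {F : ST → ℝ} {t : ℝ} {x : E2} (hF : DifferentiableAt ℝ F (t, x))
    (v : E2) : fderiv ℝ (fun y : E2 => F (t, y)) x v = fderiv ℝ F (t, x) (dXv v) := by
  have h : HasFDerivAt (fun y : E2 => F (t, y))
      ((fderiv ℝ F (t, x)).comp (ContinuousLinearMap.inr ℝ ℝ E2)) x :=
    hF.hasFDerivAt.comp x (hasFDerivAt_prodMk_right (𝕜 := ℝ) t x)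
  rw [h.fderiv]
  simp [dXv]

/-- Spatial partial derivatives are derivatives of the slices. [folklore] -/
theorem pd_dXv_eq_fderiv_slice {F : ST → ℝ} (hF : Differentiable ℝ F) (v : E2) (t : ℝ) (x : E2) :
    pd (dXv v) F (t, x) = fderiv ℝ (fun y : E2 => F (t, y)) x v := by
  rw [pd_apply, fderiv_slice_apply (hF _)]

/-- Slices of differentiable functions are differentiable. [folklore] -/
theorem differentiable_slice {F : ST → ℝ} (hF : Differentiable ℝ F) (t : ℝ) :
    Differentiable ℝ (fun y : E2 => F (t, y)) :=
  hF.comp ((differentiable_const t).prodMk differentiable_id)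

/-- Slices of `Cⁿ` functions are `Cⁿ`. [folklore] -/
theorem contDiff_slice {F : ST → ℝ} {n : ℕ∞ω} (hF : ContDiff ℝ n F) (t : ℝ) :
    ContDiff ℝ n (fun y : E2 => F (t, y)) :=
  hF.comp (contDiff_prodMk_right t)

/-- Slices of continuous functions are continuous. [folklore] -/
theorem continuous_slice {F : ST → ℝ} (hF : Continuous F) (t : ℝ) :
    Continuous (fun y : E2 => F (t, y)) :=
  hF.comp (Continuous.prodMk_right t)

/-- Slices of compactly supported functions are compactly supported (the slice support lies in
the projection of the support). [folklore] -/
theorem hasCompactSupport_slice {F : ST → ℝ} (hF : HasCompactSupport F) (t : ℝ) :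
    HasCompactSupport (fun y : E2 => F (t, y)) :=
  HasCompactSupport.of_support_subset_isCompact (hF.image continuous_snd) fun y hy =>
    ⟨(t, y), subset_tsupport F hy, rfl⟩

/-- Slices of continuous compactly supported functions are integrable. [folklore] -/
theorem integrable_slice {G : ST → ℝ} (hG : Continuous G) (hGc : HasCompactSupport G) (t : ℝ) :
    Integrable (fun x : E2 => G (t, x)) :=
  (continuous_slice hG t).integrable_of_hasCompactSupport (hasCompactSupport_slice hGc t)

/-- A compactly supported space–time function vanishes outside a slab `ℝ × B̄(0, ρ)`. [folklore] -/
theorem exists_forall_eq_zero_of_lt_norm {F : ST → ℝ} (hF : HasCompactSupport F) :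
    ∃ ρ : ℝ, 0 < ρ ∧ ∀ t x, ρ < ‖x‖ → F (t, x) = 0 := by
  obtain ⟨ρ, hρ⟩ := hF.isCompact.isBounded.subset_closedBall 0
  refine ⟨max ρ 1, by positivity, fun t x hx => ?_⟩
  by_contra h
  have hmem : (t, x) ∈ tsupport F := subset_tsupport F h
  have h' := hρ hmem
  rw [mem_closedBall, dist_zero_right] at h'
  have hx' : ‖x‖ ≤ ρ := (norm_snd_le (t, x)).trans h'
  linarith [le_max_left ρ 1]

/-- **Uniform bound of the slice `L¹` norms** of a continuous compactly supported function.
[folklore] -/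
theorem exists_forall_integral_slice_abs_le {G : ST → ℝ} (hG : Continuous G)
    (hGc : HasCompactSupport G) : ∃ M : ℝ, 0 ≤ M ∧ ∀ t, ∫ x, |G (t, x)| ≤ M := by
  obtain ⟨K, hK0, hK⟩ := exists_forall_abs_le hG hGc
  obtain ⟨ρ, hρ, hzero⟩ := exists_forall_eq_zero_of_lt_norm hGc
  refine ⟨K * volume.real (closedBall (0 : E2) ρ), by positivity, fun t => ?_⟩
  have hz : ∀ x, x ∉ closedBall (0 : E2) ρ → |G (t, x)| = 0 := fun x hx => by
    rw [hzero t x (by rwa [mem_closedBall, dist_zero_right, not_le] at hx), abs_zero]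
  rw [← setIntegral_eq_integral_of_forall_compl_eq_zero hz]
  have h := norm_setIntegral_le_of_norm_le_const (μ := volume) (s := closedBall (0 : E2) ρ)
    (f := fun x => |G (t, x)|) measure_closedBall_lt_top
    (fun x _ => by rw [Real.norm_eq_abs, abs_abs]; exact hK (t, x))
  rw [Real.norm_eq_abs, abs_of_nonneg (integral_nonneg fun x => abs_nonneg _)] at h
  exact h

/-- Slice integrals of a continuous compactly supported function depend continuously on time.
[folklore] -/
theorem continuous_integral_slice {G : ST → ℝ} (hG : Continuous G) (hGc : HasCompactSupport G) :
    Continuous fun t => ∫ x, G (t, x) := by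
  obtain ⟨ρ, hρ, hzero⟩ := exists_forall_eq_zero_of_lt_norm hGc
  have heq : ∀ t, ∫ x, G (t, x) = ∫ x in closedBall (0 : E2) ρ, G (t, x) := fun t =>
    (setIntegral_eq_integral_of_forall_compl_eq_zero fun x hx =>
      hzero t x (by rwa [mem_closedBall, dist_zero_right, not_le] at hx)).symm
  simp_rw [heq]
  exact continuous_parametric_integral_of_continuous (f := fun t x => G (t, x))
    (hG.comp (continuous_fst.prodMk continuous_snd)) (isCompact_closedBall _ _)

/-! ### Integration by parts on a slice -/

/-- **Integration by parts in `x` on a time slice:**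
`∫ ∂_{(0,v)} f (t,x) g(t,x) dx = -∫ f(t,x) ∂_{(0,v)} g(t,x) dx` for `C¹` functions, `f` compactly
supported. [folklore] -/
theorem integral_slice_pd_mul_eq_neg {f g : ST → ℝ} (hf : ContDiff ℝ 1 f) (hg : ContDiff ℝ 1 g)
    (hfc : HasCompactSupport f) (v : E2) (t : ℝ) :
    ∫ x, pd (dXv v) f (t, x) * g (t, x) = -∫ x, f (t, x) * pd (dXv v) g (t, x) := by
  have hfd := hf.differentiable one_ne_zero
  have hgd := hg.differentiable one_ne_zero
  set fs : E2 → ℝ := fun x => f (t, x) with hfs_def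
  set gs : E2 → ℝ := fun x => g (t, x) with hgs_def
  have hfs : ContDiff ℝ 1 fs := contDiff_slice hf t
  have hgs : ContDiff ℝ 1 gs := contDiff_slice hg t
  have hfsc : HasCompactSupport fs := hasCompactSupport_slice hfc t
  have e1 : ∀ x, pd (dXv v) f (t, x) = fderiv ℝ fs x v := fun x => pd_dXv_eq_fderiv_slice hfd v t x
  have e2 : ∀ x, pd (dXv v) g (t, x) = fderiv ℝ gs x v := fun x => pd_dXv_eq_fderiv_slice hgd v t x
  simp_rw [e1, e2]
  have hc1 : Continuous (fun x => fderiv ℝ fs x v) :=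
    (hfs.continuous_fderiv one_ne_zero).clm_apply continuous_const
  have hc2 : Continuous (fun x => fderiv ℝ gs x v) :=
    (hgs.continuous_fderiv one_ne_zero).clm_apply continuous_const
  have h1 : Integrable (fun x => fderiv ℝ fs x v * gs x) :=
    (hc1.mul hgs.continuous).integrable_of_hasCompactSupport
      ((hfsc.fderiv_apply (𝕜 := ℝ) v).mul_right)
  have h2 : Integrable (fun x => fs x * fderiv ℝ gs x v) :=
    (hfs.continuous.mul hc2).integrable_of_hasCompactSupport hfsc.mul_right
  have h3 : Integrable (fun x => fs x * gs x) :=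
    (hfs.continuous.mul hgs.continuous).integrable_of_hasCompactSupport hfsc.mul_right
  have h := integral_mul_fderiv_eq_neg_fderiv_mul_of_integrable (μ := (volume : Measure E2))
    h1 h2 h3 (fun x _ => hfs.differentiable one_ne_zero x)
    (fun x _ => hgs.differentiable one_ne_zero x)
  change ∫ x, fderiv ℝ fs x v * gs x = -∫ x, fs x * fderiv ℝ gs x v
  linarith

/-- `∫ ∂_{(0,v)} f (t,x) dx = 0` on every slice, for `f ∈ C¹_c`. [folklore] -/
theorem integral_slice_pd_eq_zero {f : ST → ℝ} (hf : ContDiff ℝ 1 f) (hfc : HasCompactSupport f)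
    (v : E2) (t : ℝ) : ∫ x, pd (dXv v) f (t, x) = 0 := by
  have h := integral_slice_pd_mul_eq_neg hf contDiff_const hfc v t (g := fun _ => (1 : ℝ))
  simp only [mul_one, pd_const, mul_zero, integral_zero, neg_zero] at h
  exact h

/-! ### Non-stationary phase on slices, uniformly in time -/

/-- **Non-stationary phase on a slice (one integration by parts in `x`).** For `F ∈ C¹_c(ℝ × ℝ²)`,
`N > 0` and a spatial direction `v` with `η'·v ≠ 0`:
`|∫ F(t,x) cos(Nφ_η(t,x) + kπ/2) dx| ≤ ‖∂_{(0,v)}F(t,·)‖_{L¹} / (N |η'·v|)`. [folklore] -/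
theorem abs_integral_slice_mul_osc_le {F : ST → ℝ} (hF : ContDiff ℝ 1 F) (hFc : HasCompactSupport F)
    (η : ST) {N : ℝ} (hN : 0 < N) (k : ℕ) {v : E2} (hv : phaseL η (dXv v) ≠ 0) (t : ℝ) :
    |∫ x, F (t, x) * osc η N k (t, x)|
      ≤ (∫ x, |pd (dXv v) F (t, x)|) / (N * |phaseL η (dXv v)|) := by
  have hc : N * phaseL η (dXv v) ≠ 0 := mul_ne_zero hN.ne' hv
  have hosc : ∀ z, osc η N k z = pd (dXv v) (osc η N (k + 3)) z / (N * phaseL η (dXv v)) := by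
    intro z
    rw [pd_osc, show k + 3 + 1 = k + 4 by ring, osc_add_four]
    field_simp
  have h1 : ∫ x, F (t, x) * osc η N k (t, x)
      = (∫ x, F (t, x) * pd (dXv v) (osc η N (k + 3)) (t, x)) / (N * phaseL η (dXv v)) := by
    rw [← integral_div]
    refine integral_congr_ae (Eventually.of_forall fun x => ?_)
    simp only [hosc (t, x)]
    ring
  rw [h1, ← neg_neg (∫ x, F (t, x) * pd (dXv v) (osc η N (k + 3)) (t, x)),
    ← integral_slice_pd_mul_eq_neg hF ((contDiff_osc η N (k + 3)).of_le one_le_infty) hFc v t,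
    abs_div, abs_neg, abs_mul, abs_of_pos hN]
  gcongr
  calc |∫ x, pd (dXv v) F (t, x) * osc η N (k + 3) (t, x)|
      ≤ ∫ x, |pd (dXv v) F (t, x) * osc η N (k + 3) (t, x)| := abs_integral_le_integral_abs
    _ ≤ ∫ x, |pd (dXv v) F (t, x)| := by
        refine integral_mono_of_nonneg (Eventually.of_forall fun x => abs_nonneg _) ?_
          (Eventually.of_forall fun x => ?_)
        · exact (integrable_slice (continuous_pd hF _) (hasCompactSupport_pd hFc _) t).abs
        · simp only
          rw [abs_mul]
          exact mul_le_of_le_one_right (abs_nonneg _) (abs_osc_le_one _ _ _ _)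

/-- **Riemann–Lebesgue on slices, uniformly in time** (DLSz 2010, Lemma 4.9 and §4.5 Step 3, in
quantitative form): for `F ∈ C¹_c(ℝ × ℝ²)` and a frequency with non-zero spatial part there is
`K ≥ 0` with `|∫ F(t,x) cos(Nφ_η(t,x) + kπ/2) dx| ≤ K/N` for all `t` and all `N > 0`.
[cite: DeLellisSzekelyhidi2010, Lemma 4.9] -/
theorem exists_forall_abs_integral_slice_mul_osc_le {F : ST → ℝ} (hF : ContDiff ℝ 1 F)
    (hFc : HasCompactSupport F) {η : ST} (hη : η.2 ≠ 0) (k : ℕ) :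
    ∃ K : ℝ, 0 ≤ K ∧ ∀ N : ℝ, 0 < N → ∀ t, |∫ x, F (t, x) * osc η N k (t, x)| ≤ K / N := by
  have hv : phaseL η (dXv η.2) ≠ 0 := by
    rw [phaseL_dXv, real_inner_self_eq_norm_sq]
    exact pow_ne_zero 2 (norm_ne_zero_iff.mpr hη)
  obtain ⟨M, hM0, hM⟩ := exists_forall_integral_slice_abs_le (continuous_pd hF (dXv η.2))
    (hasCompactSupport_pd hFc _)
  have hph : 0 < |phaseL η (dXv η.2)| := abs_pos.mpr hv
  refine ⟨M / |phaseL η (dXv η.2)|, by positivity, fun N hN t => ?_⟩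
  calc |∫ x, F (t, x) * osc η N k (t, x)|
      ≤ (∫ x, |pd (dXv η.2) F (t, x)|) / (N * |phaseL η (dXv η.2)|) :=
        abs_integral_slice_mul_osc_le hF hFc η hN k hv t
    _ ≤ M / (N * |phaseL η (dXv η.2)|) := by gcongr; exact hM t
    _ = M / |phaseL η (dXv η.2)| / N := by rw [div_div, mul_comm]

/-- Uniform-in-time Riemann–Lebesgue, `∀ᶠ` form: eventually in `N`, `|∫ F(t,x) osc dx| ≤ ε` for
all `t`. [cite: DeLellisSzekelyhidi2010, Lemma 4.9] -/
theorem eventually_forall_abs_integral_slice_mul_osc_le {F : ST → ℝ} (hF : ContDiff ℝ 1 F)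
    (hFc : HasCompactSupport F) {η : ST} (hη : η.2 ≠ 0) (k : ℕ) {ε : ℝ} (hε : 0 < ε) :
    ∀ᶠ N : ℝ in atTop, ∀ t, |∫ x, F (t, x) * osc η N k (t, x)| ≤ ε := by
  obtain ⟨K, hK0, hK⟩ := exists_forall_abs_integral_slice_mul_osc_le hF hFc hη k
  filter_upwards [eventually_ge_atTop (K / ε + 1), eventually_gt_atTop (0 : ℝ)] with N hN hN0 t
  refine (hK N hN0 t).trans ?_
  rw [div_le_iff₀ hN0]
  calc K = (K / ε) * ε := by field_simp
    _ ≤ N * ε := by gcongr; linarith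
    _ = ε * N := mul_comm _ _

/-! ### Slices of localized plane waves -/

namespace WaveData

variable (d : WaveData)

/-- The spatial frequency is non-zero (a unit vector). [folklore] -/
theorem ξ_ne_zero : d.ξ ≠ 0 := by
  intro h
  have h0 : d.ξ 0 = 0 := by rw [h]; rfl
  have h1 : d.ξ 1 = 0 := by rw [h]; rfl
  rw [ξ_zero] at h0
  rw [ξ_one] at h1
  have := d.hn
  nlinarith

/-- The spatial part of the space–time frequency `η = (-μ, ξ)` is `ξ ≠ 0`. [folklore] -/
theorem η_snd_ne_zero : d.η.2 ≠ 0 := d.ξ_ne_zero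

/-- Off the spatial ball `B(x₀, r)` every slice of the wave vanishes. [folklore] -/
theorem wave_slice_eq_zero {N : ℝ} {i : Fin 4} {t : ℝ} {x : E2} (hx : x ∉ ball d.c.2 d.r) :
    d.wave N i (t, x) = 0 :=
  d.wave_eq_zero fun h => hx <| by
    rw [mem_ball, Prod.dist_eq] at h
    exact mem_ball.mpr (lt_of_le_of_lt (le_max_right _ _) h)

/-- Off the spatial ball `B(x₀, r)` every slice of the main term vanishes. [folklore] -/
theorem waveMain_slice_eq_zero {N : ℝ} {i : Fin 4} {t : ℝ} {x : E2} (hx : x ∉ ball d.c.2 d.r) :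
    d.waveMain N i (t, x) = 0 :=
  d.waveMain_eq_zero fun h => hx <| by
    rw [mem_ball, Prod.dist_eq] at h
    exact mem_ball.mpr (lt_of_le_of_lt (le_max_right _ _) h)

/-- Off the spatial ball `B(x₀, r)` every slice of the cutoff vanishes. [folklore] -/
theorem cutoff_slice_eq_zero {t : ℝ} {x : E2} (hx : x ∉ ball d.c.2 d.r) : d.cutoff (t, x) = 0 :=
  image_eq_zero_of_notMem_tsupport fun h => hx <| by
    have h' := d.tsupport_cutoff_subset_ball h
    rw [mem_ball, Prod.dist_eq] at h'
    exact mem_ball.mpr (lt_of_le_of_lt (le_max_right _ _) h')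

/-- **Near-orthogonality of the slices of the wave to a fixed amplitude, uniformly in time:**
eventually in `N`, `|∫ wave_N,i(t,x) f(t,x) dx| ≤ ε` for all `t`, for `f ∈ C¹_c`
(DLSz 2010, §4.5 Step 3: `∫ ṽ_N · v dx → 0` uniformly in `t`).
[cite: DeLellisSzekelyhidi2010, §4.5 (Step 3)] -/
theorem wave_slice_integral_mul_eventually {f : ST → ℝ} (hf : ContDiff ℝ 1 f)
    (hfc : HasCompactSupport f) (i : Fin 4) {ε : ℝ} (hε : 0 < ε) :
    ∀ᶠ N : ℝ in atTop, ∀ t, |∫ x, d.wave N i (t, x) * f (t, x)| ≤ ε := by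
  obtain ⟨If, hIf, hIfb⟩ := exists_forall_integral_slice_abs_le hf.continuous hfc
  have ha : 0 < |d.A * d.Dvec i| + 1 := by positivity
  have hρ : 0 < ε / 2 / (If + 1) := by positivity
  have hχ1 : ContDiff ℝ 1 d.cutoff := d.contDiff_cutoff.of_le one_le_infty
  -- the main term is an oscillatory slice integral, uniformly small in `t`
  have h3 : ∀ᶠ N : ℝ in atTop, ∀ t,
      |∫ x, (d.cutoff (t, x) * f (t, x)) * osc d.η N 3 (t, x)| ≤ ε / 2 / (|d.A * d.Dvec i| + 1) :=
    eventually_forall_abs_integral_slice_mul_osc_le (F := fun z => d.cutoff z * f z) (hχ1.mul hf)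
      (d.hasCompactSupport_cutoff.mul_right) d.η_snd_ne_zero 3 (by positivity)
  filter_upwards [d.wave_eventually_close hρ, h3] with N hN1 hN3 t
  have hsplit : ∀ x, d.wave N i (t, x) * f (t, x)
      = d.A * d.Dvec i * ((d.cutoff (t, x) * f (t, x)) * osc d.η N 3 (t, x))
        + (d.wave N i (t, x) - d.waveMain N i (t, x)) * f (t, x) := by
    intro x; simp only [waveMain]; ring
  have hI1 : Integrable (fun x => d.A * d.Dvec i * ((d.cutoff (t, x) * f (t, x)) * osc d.η N 3 (t, x))) :=
    (integrable_slice (G := fun z => (d.cutoff z * f z) * osc d.η N 3 z)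
      ((d.contDiff_cutoff.continuous.mul hf.continuous).mul (contDiff_osc _ _ _).continuous)
      (hfc.mul_left.mul_right) t).const_mul _
  have hI2 : Integrable (fun x => (d.wave N i (t, x) - d.waveMain N i (t, x)) * f (t, x)) :=
    integrable_slice (G := fun z => (d.wave N i z - d.waveMain N i z) * f z)
      (((d.continuous_wave N i).sub (d.continuous_waveMain N i)).mul hf.continuous) hfc.mul_left t
  have hfi : Integrable (fun x => f (t, x)) := integrable_slice hf.continuous hfc t
  have e1 : (|d.A * d.Dvec i| + 1) * (ε / 2 / (|d.A * d.Dvec i| + 1)) = ε / 2 := by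
    field_simp
  have e2 : ε / 2 / (If + 1) * If ≤ ε / 2 := by
    rw [div_mul_eq_mul_div, div_le_iff₀ (by positivity)]
    nlinarith
  simp_rw [hsplit]
  rw [integral_add hI1 hI2, integral_const_mul]
  calc _ ≤ |d.A * d.Dvec i * ∫ x, (d.cutoff (t, x) * f (t, x)) * osc d.η N 3 (t, x)|
        + |∫ x, (d.wave N i (t, x) - d.waveMain N i (t, x)) * f (t, x)| := abs_add_le _ _
    _ ≤ (|d.A * d.Dvec i| + 1) * (ε / 2 / (|d.A * d.Dvec i| + 1)) + ε / 2 / (If + 1) * If := by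
        refine add_le_add ?_ ?_
        · rw [abs_mul]
          exact mul_le_mul (by linarith) (hN3 t) (abs_nonneg _) ha.le
        · calc _ ≤ ∫ x, |(d.wave N i (t, x) - d.waveMain N i (t, x)) * f (t, x)| :=
                abs_integral_le_integral_abs
            _ ≤ ∫ x, ε / 2 / (If + 1) * |f (t, x)| := by
                refine integral_mono hI2.abs (hfi.abs.const_mul _) fun x => ?_
                simp only
                rw [abs_mul]
                exact mul_le_mul_of_nonneg_right (hN1 i (t, x)) (abs_nonneg _)
            _ = ε / 2 / (If + 1) * ∫ x, |f (t, x)| := integral_const_mul _ _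
            _ ≤ ε / 2 / (If + 1) * If := by gcongr; exact hIfb t
    _ ≤ ε / 2 + ε / 2 := by rw [e1]; exact add_le_add le_rfl e2
    _ = ε := by ring

/-- The error term `E = 2m₀(w₀-m₀) + (w₀-m₀)² + 2m₁(w₁-m₁) + (w₁-m₁)²` in the pointwise energy
identity `w₀² + w₁² = m₀² + m₁² + E` (`w = wave`, `m = waveMain`). [folklore] -/
def errE (N : ℝ) (z : ST) : ℝ :=
  2 * d.waveMain N 0 z * (d.wave N 0 z - d.waveMain N 0 z) + (d.wave N 0 z - d.waveMain N 0 z) ^ 2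
    + 2 * d.waveMain N 1 z * (d.wave N 1 z - d.waveMain N 1 z)
    + (d.wave N 1 z - d.waveMain N 1 z) ^ 2

/-- **Pointwise energy identity:** `w₀² + w₁² = A²/2 χ² - A²/2 χ² cos(2Nφ_η) + E`
(`sin² = ½ - ½cos 2·`). [folklore] -/
theorem wave_sq_add_sq_eq (N : ℝ) (z : ST) :
    d.wave N 0 z ^ 2 + d.wave N 1 z ^ 2
      = (d.A ^ 2 / 2 * d.cutoff z ^ 2 - d.A ^ 2 / 2 * (d.cutoff z ^ 2 * osc d.η (2 * N) 0 z))
        + d.errE N z := by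
  have hn := d.hn
  have hm : d.waveMain N 0 z ^ 2 + d.waveMain N 1 z ^ 2
      = d.A ^ 2 * d.cutoff z ^ 2 * osc d.η N 3 z ^ 2 := by
    simp only [waveMain, Dvec_zero, Dvec_one]
    linear_combination (d.A * d.cutoff z * osc d.η N 3 z) ^ 2 * hn
  have ho := osc_three_sq d.η N z
  simp only [errE]
  linear_combination hm + d.A ^ 2 * d.cutoff z ^ 2 * ho

/-- The error term is continuous. [folklore] -/
theorem continuous_errE (N : ℝ) : Continuous (d.errE N) := by
  have hwc : ∀ i, Continuous (d.wave N i) := d.continuous_wave N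
  have hmc : ∀ i, Continuous (d.waveMain N i) := d.continuous_waveMain N
  unfold errE
  fun_prop

/-- The error term vanishes off the space–time ball. [folklore] -/
theorem errE_eq_zero {N : ℝ} {z : ST} (hz : z ∉ ball d.c d.r) : d.errE N z = 0 := by
  simp only [errE, d.wave_eq_zero hz, d.waveMain_eq_zero hz]
  ring

/-- Every slice of the error term vanishes off the spatial ball. [folklore] -/
theorem errE_slice_eq_zero {N t : ℝ} {x : E2} (hx : x ∉ ball d.c.2 d.r) : d.errE N (t, x) = 0 := by
  simp only [errE, d.wave_slice_eq_zero hx, d.waveMain_slice_eq_zero hx]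
  ring

/-- The error term is compactly supported. [folklore] -/
theorem hasCompactSupport_errE (N : ℝ) : HasCompactSupport (d.errE N) :=
  HasCompactSupport.intro (isCompact_closedBall d.c d.r) fun _ hz =>
    d.errE_eq_zero fun h => hz (ball_subset_closedBall h)

/-- If the wave is `ρ`-close to its main term (`ρ ≤ 1`), the error term is at most `(4|A|+2)ρ`.
[folklore] -/
theorem abs_errE_le {N ρ : ℝ} (hρ : 0 < ρ) (hρ1 : ρ ≤ 1)
    (hR : ∀ i z, |d.wave N i z - d.waveMain N i z| ≤ ρ) (z : ST) :
    |d.errE N z| ≤ (4 * |d.A| + 2) * ρ := by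
  have h0 := hR 0 z
  have h1 := hR 1 z
  have hm0 : |d.waveMain N 0 z| ≤ |d.A| := d.abs_waveMain_le N (i := 0) (by norm_num) z
  have hm1 : |d.waveMain N 1 z| ≤ |d.A| := d.abs_waveMain_le N (i := 1) (by norm_num) z
  have e1 : |2 * d.waveMain N 0 z * (d.wave N 0 z - d.waveMain N 0 z)| ≤ 2 * |d.A| * ρ := by
    rw [abs_mul, abs_mul, abs_two]
    exact mul_le_mul (mul_le_mul_of_nonneg_left hm0 zero_le_two) h0 (abs_nonneg _) (by positivity)
  have e2 : |2 * d.waveMain N 1 z * (d.wave N 1 z - d.waveMain N 1 z)| ≤ 2 * |d.A| * ρ := by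
    rw [abs_mul, abs_mul, abs_two]
    exact mul_le_mul (mul_le_mul_of_nonneg_left hm1 zero_le_two) h1 (abs_nonneg _) (by positivity)
  have e3 : |(d.wave N 0 z - d.waveMain N 0 z) ^ 2| ≤ ρ := by
    rw [abs_pow, sq]
    calc _ ≤ ρ * 1 := mul_le_mul h0 (h0.trans hρ1) (abs_nonneg _) hρ.le
      _ = ρ := mul_one ρ
  have e4 : |(d.wave N 1 z - d.waveMain N 1 z) ^ 2| ≤ ρ := by
    rw [abs_pow, sq]
    calc _ ≤ ρ * 1 := mul_le_mul h1 (h1.trans hρ1) (abs_nonneg _) hρ.le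
      _ = ρ := mul_one ρ
  unfold errE
  calc _ ≤ |2 * d.waveMain N 0 z * (d.wave N 0 z - d.waveMain N 0 z)
          + (d.wave N 0 z - d.waveMain N 0 z) ^ 2
          + 2 * d.waveMain N 1 z * (d.wave N 1 z - d.waveMain N 1 z)|
        + |(d.wave N 1 z - d.waveMain N 1 z) ^ 2| := abs_add_le _ _
    _ ≤ |2 * d.waveMain N 0 z * (d.wave N 0 z - d.waveMain N 0 z)
          + (d.wave N 0 z - d.waveMain N 0 z) ^ 2|
        + |2 * d.waveMain N 1 z * (d.wave N 1 z - d.waveMain N 1 z)|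
        + |(d.wave N 1 z - d.waveMain N 1 z) ^ 2| := by gcongr; exact abs_add_le _ _
    _ ≤ |2 * d.waveMain N 0 z * (d.wave N 0 z - d.waveMain N 0 z)|
        + |(d.wave N 0 z - d.waveMain N 0 z) ^ 2|
        + |2 * d.waveMain N 1 z * (d.wave N 1 z - d.waveMain N 1 z)|
        + |(d.wave N 1 z - d.waveMain N 1 z) ^ 2| := by gcongr; exact abs_add_le _ _
    _ ≤ 2 * |d.A| * ρ + ρ + 2 * |d.A| * ρ + ρ := by gcongr
    _ = (4 * |d.A| + 2) * ρ := by ring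

/-- Slice integrals of the error term: `|∫ E(t,x) dx| ≤ (4|A|+2) ρ |B(x₀,r)|`. [folklore] -/
theorem abs_integral_slice_errE_le {N ρ : ℝ} (hρ : 0 < ρ) (hρ1 : ρ ≤ 1)
    (hR : ∀ i z, |d.wave N i z - d.waveMain N i z| ≤ ρ) (t : ℝ) :
    |∫ x, d.errE N (t, x)| ≤ (4 * |d.A| + 2) * ρ * volume.real (ball d.c.2 d.r) := by
  rw [← setIntegral_eq_integral_of_forall_compl_eq_zero (s := ball d.c.2 d.r)
    (fun x hx => d.errE_slice_eq_zero hx)]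
  have := norm_setIntegral_le_of_norm_le_const (μ := volume) (s := ball d.c.2 d.r)
    (f := fun x => d.errE N (t, x)) measure_ball_lt_top
    (fun x _ => (Real.norm_eq_abs _).le.trans (d.abs_errE_le hρ hρ1 hR (t, x)))
  simpa [Real.norm_eq_abs] using this

/-- **Energy of the slices of the wave, uniformly in time** (DLSz 2010, Lemma 4.9:
`∫_B sin²(Nη·(x,t)) dx → |B|/2` uniformly in `t`): eventually in `N`, for all `t`,
`|∫ (wave₀² + wave₁²)(t,x) dx - A²/2 ∫ χ(t,x)² dx| ≤ ε`. [cite: DeLellisSzekelyhidi2010, Lemma 4.9] -/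
theorem wave_slice_energy_eventually {ε : ℝ} (hε : 0 < ε) :
    ∀ᶠ N : ℝ in atTop, ∀ t, |(∫ x, (d.wave N 0 (t, x) ^ 2 + d.wave N 1 (t, x) ^ 2))
      - d.A ^ 2 / 2 * ∫ x, d.cutoff (t, x) ^ 2| ≤ ε := by
  have hV : 0 ≤ volume.real (ball d.c.2 d.r) := measureReal_nonneg
  have hden : 0 < (4 * |d.A| + 2) * volume.real (ball d.c.2 d.r) + 1 := by positivity
  obtain ⟨ρ, hρ, hρ1, hρ2⟩ : ∃ ρ : ℝ, 0 < ρ ∧ ρ ≤ 1 ∧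
      (4 * |d.A| + 2) * ρ * volume.real (ball d.c.2 d.r) ≤ ε / 2 := by
    refine ⟨min 1 (ε / 2 / ((4 * |d.A| + 2) * volume.real (ball d.c.2 d.r) + 1)),
      lt_min one_pos (by positivity), min_le_left _ _, ?_⟩
    calc (4 * |d.A| + 2) * min 1 (ε / 2 / ((4 * |d.A| + 2) * volume.real (ball d.c.2 d.r) + 1))
          * volume.real (ball d.c.2 d.r)
        ≤ (4 * |d.A| + 2) * (ε / 2 / ((4 * |d.A| + 2) * volume.real (ball d.c.2 d.r) + 1))
          * volume.real (ball d.c.2 d.r) := by gcongr; exact min_le_right _ _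
      _ = ε / 2 * ((4 * |d.A| + 2) * volume.real (ball d.c.2 d.r)
          / ((4 * |d.A| + 2) * volume.real (ball d.c.2 d.r) + 1)) := by
          field_simp
      _ ≤ ε / 2 * 1 := by gcongr; rw [div_le_one hden]; linarith
      _ = ε / 2 := mul_one _
  have hχ := d.contDiff_cutoff
  have hχc := d.hasCompactSupport_cutoff
  have hχ1 : ContDiff ℝ 1 (fun z => d.cutoff z ^ 2) := (hχ.pow 2).of_le one_le_infty
  have hχ2c : HasCompactSupport (fun z => d.cutoff z ^ 2) :=
    hχc.comp_left (g := fun t : ℝ => t ^ 2) (by norm_num)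
  have ha : 0 < d.A ^ 2 / 2 + 1 := by positivity
  -- the oscillatory part of the main energy, uniformly small in `t` (frequency `2N`)
  have hO : ∀ᶠ N : ℝ in atTop, ∀ t,
      |∫ x, d.cutoff (t, x) ^ 2 * osc d.η (2 * N) 0 (t, x)| ≤ ε / 2 / (d.A ^ 2 / 2 + 1) := by
    have h1 := eventually_forall_abs_integral_slice_mul_osc_le hχ1 hχ2c d.η_snd_ne_zero 0
      (ε := ε / 2 / (d.A ^ 2 / 2 + 1)) (by positivity)
    exact (tendsto_id.const_mul_atTop (by norm_num : (0 : ℝ) < 2)).eventually h1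
  filter_upwards [d.wave_eventually_close hρ, hO] with N hR hON t
  have hEi : Integrable (fun x => d.errE N (t, x)) :=
    integrable_slice (d.continuous_errE N) (d.hasCompactSupport_errE N) t
  have hI1 : Integrable (fun x => d.A ^ 2 / 2 * d.cutoff (t, x) ^ 2) :=
    (integrable_slice (G := fun z => d.cutoff z ^ 2) hχ1.continuous hχ2c t).const_mul (d.A ^ 2 / 2)
  have hc2 : Continuous (fun z => d.cutoff z ^ 2 * osc d.η (2 * N) 0 z) :=
    hχ1.continuous.mul (contDiff_osc _ _ _).continuous
  have hcs2 : HasCompactSupport (fun z => d.cutoff z ^ 2 * osc d.η (2 * N) 0 z) := hχ2c.mul_right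
  have hI2 : Integrable (fun x => d.A ^ 2 / 2 * (d.cutoff (t, x) ^ 2 * osc d.η (2 * N) 0 (t, x))) :=
    (integrable_slice hc2 hcs2 t).const_mul (d.A ^ 2 / 2)
  have hsplit : ∫ x, (d.wave N 0 (t, x) ^ 2 + d.wave N 1 (t, x) ^ 2)
      = d.A ^ 2 / 2 * (∫ x, d.cutoff (t, x) ^ 2)
        - d.A ^ 2 / 2 * (∫ x, d.cutoff (t, x) ^ 2 * osc d.η (2 * N) 0 (t, x))
        + ∫ x, d.errE N (t, x) := by
    have hI12 : Integrable (fun x => d.A ^ 2 / 2 * d.cutoff (t, x) ^ 2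
        - d.A ^ 2 / 2 * (d.cutoff (t, x) ^ 2 * osc d.η (2 * N) 0 (t, x))) := hI1.sub hI2
    rw [integral_congr_ae (Eventually.of_forall fun x => d.wave_sq_add_sq_eq N (t, x)),
      integral_add hI12 hEi, integral_sub hI1 hI2, integral_const_mul, integral_const_mul]
  have hEint := d.abs_integral_slice_errE_le hρ hρ1 hR t
  have e1 : (d.A ^ 2 / 2 + 1) * (ε / 2 / (d.A ^ 2 / 2 + 1)) = ε / 2 := by field_simp
  rw [hsplit]
  calc _ = |-(d.A ^ 2 / 2 * ∫ x, d.cutoff (t, x) ^ 2 * osc d.η (2 * N) 0 (t, x))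
        + ∫ x, d.errE N (t, x)| := by congr 1; ring
    _ ≤ |-(d.A ^ 2 / 2 * ∫ x, d.cutoff (t, x) ^ 2 * osc d.η (2 * N) 0 (t, x))|
        + |∫ x, d.errE N (t, x)| := abs_add_le _ _
    _ ≤ (d.A ^ 2 / 2 + 1) * (ε / 2 / (d.A ^ 2 / 2 + 1))
        + (4 * |d.A| + 2) * ρ * volume.real (ball d.c.2 d.r) := by
        rw [abs_neg, abs_mul]
        refine add_le_add ?_ hEint
        refine mul_le_mul ?_ (hON t) (abs_nonneg _) ha.le
        rw [abs_of_nonneg (by positivity)]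
        linarith
    _ ≤ ε / 2 + ε / 2 := by rw [e1]; exact add_le_add le_rfl hρ2
    _ = ε := by ring

/-- On a fully active slice `|t - t₀| < r/2` the cutoff has slice energy at least the area of
the planar half-radius disc `B(x₀, r/2)`. [folklore] -/
theorem volume_ball_le_integral_slice_cutoff_sq {t : ℝ} (ht : dist t d.c.1 < d.r / 2) :
    volume.real (ball d.c.2 (d.r / 2)) ≤ ∫ x, d.cutoff (t, x) ^ 2 := by
  have hχ2c : HasCompactSupport (fun z => d.cutoff z ^ 2) :=
    d.hasCompactSupport_cutoff.comp_left (g := fun t : ℝ => t ^ 2) (by norm_num)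
  have hI : Integrable (fun x => d.cutoff (t, x) ^ 2) :=
    integrable_slice (d.contDiff_cutoff.continuous.pow 2) hχ2c t
  rw [← integral_indicator_one (μ := volume) (measurableSet_ball (x := d.c.2) (ε := d.r / 2))]
  refine integral_mono ?_ hI fun x => ?_
  · exact (integrable_indicator_iff measurableSet_ball).mpr
      ((integrableOn_const_iff).mpr (Or.inr measure_ball_lt_top))
  · by_cases hx : x ∈ ball d.c.2 (d.r / 2)
    · rw [indicator_of_mem hx, d.cutoff_eq_one]
      · norm_num
      · rw [mem_ball, Prod.dist_eq]
        exact max_lt ht (mem_ball.mp hx)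
    · rw [indicator_of_notMem hx]
      positivity

/-- The slice energy of the cutoff is at most the area of the planar disc `B(x₀, r)`. [folklore] -/
theorem integral_slice_cutoff_sq_le (t : ℝ) :
    ∫ x, d.cutoff (t, x) ^ 2 ≤ volume.real (ball d.c.2 d.r) := by
  rw [← setIntegral_eq_integral_of_forall_compl_eq_zero (s := ball d.c.2 d.r)
    (fun x hx => by rw [d.cutoff_slice_eq_zero hx]; ring)]
  have := norm_setIntegral_le_of_norm_le_const (μ := volume) (s := ball d.c.2 d.r)
    (f := fun x => d.cutoff (t, x) ^ 2) (C := 1) measure_ball_lt_top (fun x _ => by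
      rw [Real.norm_eq_abs, abs_of_nonneg (sq_nonneg _), sq_le_one_iff_abs_le_one]
      exact d.abs_cutoff_le_one _)
  rw [one_mul, Real.norm_eq_abs, abs_of_nonneg (integral_nonneg fun x => sq_nonneg _)] at this
  exact this

end WaveData

end Literature.Analysis.FluidPDE.ConvexIntegration
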